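import Literature.Computability.AlgebraicComplexity.GKSS19BootstrappingHardFamily
import Literature.Computability.AlgebraicComplexity.GKSS19Thm5Explicit
import Literature.Computability.Complexity.DeterminantFP
import HarnessLib

/-!
# GKSS19 ‹Bootstrapping hitting sets›, II: explicitness of the hard family and the discharge `GKSS2019_bootstrapping_holds`

Guo–Kumar–Saptharishi–Solomon, *Derandomization from algebraic hardness* (arXiv:1905.00091 = SIAM
J. Comput. 51 (2022)), ‹Bootstrapping hitting sets› (arXiv p0005.txt:L44–p0006.txt:L2; = ECCC
TR19-065r2 Thm 1.7; typed `GKSS2019_bootstrapping`, `GKSS19HardnessToHittingSets.lean`), proof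
§3.3 (p0013.txt:L56 – p0014.txt:L8): "… Hence, `{P_s}` is an explicit family of `k`-variate,
degree-`d` polynomials that require circuits of size `d^{δ/2}`. Therefore, [‹Thm 5›] yields an
explicit `poly_{δ,k}(s)`-sized hitting set for [`𝒞(s,s,s)`]."

`GKSS19BootstrappingHardFamily.lean` constructs that family (`bootFamily k H₀ d = z_0^d +
P_{s(d)}(z_1..z_k)`, the vanishing polynomial of the `s(d)`-th hitting set found by integer
determinants, padded to exact degree `d`) and proves its degree and eventual hardness. This file
(theorems + definitions with bodies, NO named facts) supplies the remaining hypothesis of the typed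
‹Thm 5› — EXPLICITNESS in the dense representation ("a deterministic `poly(d)`-time algorithm that,
on input `1^d`, outputs `P_d` as a sum of monomials", Question 4 footnote, p0005.txt:L2) — and the
discharge:

* §Lex/§Dense — WHAT the machine must output: the tree's `denseList` sorts the support
  lexicographically (Mathlib's order on `List ℕ`), so `pairwise_lex_gridLists` (the exponent
  enumeration `gridLists` is strictly lex-increasing), the uniqueness lemma `denseList_eq_of` (a
  strictly increasing, correct and covering list of monomials IS `denseList`), and
  **`denseList_bootFamily`**: for `d ≥ 1`, `denseList (bootFamily k H₀ d) = bootDense k H₀ d` = the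
  monomials `0 :: e_i` with nonzero kernel coefficient `x_i` in increasing `i`, then the padding
  monomial `d :: 0^k` (lex-last).
* §Program — the construction as a LIST PROGRAM around the tree's polynomial-time integer
  determinant `IntDetFP.detZ` (`DeterminantFP.lean`): `ndRow`, `entryP`, `tableP` (the integer
  evaluation table), `gramP` (Gram rows of a column prefix), `firstSingP` (first singular prefix by
  `detZ`), `adjP` (adjugate entry = `detZ` of the Gram rows with the last row replaced by a unit
  row, Mathlib `adjugate_apply`), `kerCoeffP`, `bootDenseP`; and that it computes the
  construction: `tableP_eq` (`= rows (evalMatrix …)`), `gramP_eq`, `detZ_gramP` (`detZ_rows`),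
  `firstSingP_eq`, `adjP_eq`, `kerCoeffP_eq`, **`bootDenseP_eq : bootDenseP = bootDense`**.
* §Code — the same program ON CODES, assembled from the typed `CodeFP` combinators (`map`,
  `zipWith`, `filter`, `findIdxFP`, `rawTakeNat`, `rawGetOr`, `intPow` with unary exponents `≤ s`,
  `intSum`, a private `intProd`, `detZ_codeFP`, `gridListsFP`, `smOfInt`, …; no machine written):
  `ndRowFP`, `entryFP`, `tableFP`, `gramFP`, `firstSingFP`, `adjFP`, `kerCoeffFP`,
  `bootDensePFP : CodeFP unE (listE monoE) (bootDenseP k H₀)` for an explicit point family `H₀`,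
  and **`isExplicitFamily_bootFamily`** (the member `d = 0` is output as a constant).
* **`GKSS2019_bootstrapping_holds : GKSS2019_bootstrapping`** — ‹Thm 5› (`GKSS2019_thm_5_holds`,
  `GKSS19Thm5Explicit.lean`) applied to `bootFamily` with `k+1` variables and exponent `δ/2`
  (`isExplicitFamily_bootFamily`, `totalDegree_bootFamily`, `eventually_hard_bootFamily`).

Deviations from print (disclosed): `k+1` variables (padding variable; ‹Thm 5› allows any constant
number of variables); the polynomial `P_s` is a specific kernel vector (print: "obtain a
polynomial"). HONEST FRAMING: a formalization of a published 2019 theorem over `ℚ`; nothing here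
bears on VP ≠ VNP.

## References
* [GuoKumarSaptharishiSolomon2019] arXiv:1905.00091, ‹Bootstrapping hitting sets› (p.5 L44 – p.6
  L2), §3.3 proof (p.13 L56 – p.14 L8), ‹Thm 15› (p.9 L47-48), Question 4 footnote (p.5 L2), §1.2
  (p.6 L28, "enumerated by a deterministic Turing machine in time poly(s)").
* [AroraBarak2009] S. Arora, B. Barak, *Computational Complexity*, §1.3 (closure of polynomial time
  under composition and polynomially bounded loops).
* [Berkowitz1984] S. J. Berkowitz, Inform. Process. Lett. 18 (1984) — the determinant program behind
  `IntDetFP.detZ_codeFP` (tree `DeterminantFP.lean`).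
-/

noncomputable section

open MvPolynomial Matrix

namespace Literature.Computability.AlgebraicComplexity

namespace GKSS2019

open Literature.Barriers.ValiantsHypothesis HittingSets

/-! ### Lexicographic order of the exponent enumeration -/

section Lex

/-- `gridLists n W` is strictly increasing in the lexicographic order. [cite: GuoKumarSaptharishiSolomon2019, §3.2–§3.3 (arXiv p0013.txt:L24-27, L57-60), proof step] -/
theorem pairwise_lex_gridLists : ∀ n W : ℕ, (gridLists n W).Pairwise (List.Lex (· < ·))
  | 0, _ => by simp [gridLists]
  | n + 1, W => by
    rw [gridLists, List.pairwise_map]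
    have ih := pairwise_lex_gridLists n W
    rw [List.product, List.pairwise_flatMap]
    constructor
    · intro a _
      rw [List.pairwise_map]
      exact ih.imp fun h => List.Lex.cons h
    · refine List.pairwise_lt_range.imp fun {a b} hab => ?_
      intro x hx y hy
      obtain ⟨l, -, rfl⟩ := List.mem_map.mp hx
      obtain ⟨m, -, rfl⟩ := List.mem_map.mp hy
      exact List.Lex.rel hab

/-- The strict lexicographic order on `List ℕ` is irreflexive. [folklore] -/
private theorem lex_irrefl : ∀ l : List ℕ, ¬ List.Lex (· < ·) l l
  | [], h => by cases h
  | a :: l, h => by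
    cases h with
    | cons h => exact lex_irrefl l h
    | rel h => exact lt_irrefl a h

/-- **Uniqueness of dense lists**: a list of (exponent list, (numerator, denominator)) entries whose
keys are strictly lex-increasing, each of which is a genuine monomial of `P` with its coefficient,
and which covers the support of `P`, IS `denseList P`. [cite: GuoKumarSaptharishiSolomon2019, Question 4 footnote (arXiv p0005.txt:L2, "outputs P_d as a sum of monomials")] -/
theorem denseList_eq_of {n : ℕ} (P : MvPolynomial (Fin n) ℚ) (L : List (List ℕ × (ℤ × ℕ)))
    (hsorted : (L.map Prod.fst).Pairwise (List.Lex (· < ·)))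
    (hmem : ∀ x ∈ L, ∃ e ∈ P.support, x = (List.ofFn e, ((coeff e P).num, (coeff e P).den)))
    (hcov : ∀ e ∈ P.support, (List.ofFn e : List ℕ) ∈ L.map Prod.fst) :
    denseList P = L := by
  classical
  set S : Finset (List ℕ) := P.support.image fun e : Fin n →₀ ℕ => List.ofFn fun i : Fin n => e i
    with hS
  set g : List ℕ → List ℕ × (ℤ × ℕ) := fun l =>
    (l, ((coeff (Finsupp.equivFunOnFinite.symm fun i : Fin n => l.getD i.val 0) P).num,
      (coeff (Finsupp.equivFunOnFinite.symm fun i : Fin n => l.getD i.val 0) P).den)) with hg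
  have hdl : denseList P = (S.sort (· ≤ ·)).map g := rfl
  set K := L.map Prod.fst with hK
  have hnodupK : K.Nodup := hsorted.imp fun {a b} h hab => by subst hab; exact lex_irrefl _ h
  have hsortK : K.Pairwise (· ≤ ·) := hsorted.imp fun {a b} h => show a ≤ b from Or.inr h
  have hmemK : ∀ l, l ∈ K ↔ l ∈ S := fun l => by
    constructor
    · intro hl
      obtain ⟨x, hx, rfl⟩ := List.mem_map.mp hl
      obtain ⟨e, he, rfl⟩ := hmem x hx
      exact Finset.mem_image.mpr ⟨e, he, rfl⟩
    · intro hl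
      obtain ⟨e, he, rfl⟩ := Finset.mem_image.mp hl
      exact hcov e he
  have hKS : K = S.sort (· ≤ ·) :=
    List.Perm.eq_of_pairwise' hsortK (Finset.pairwise_sort _ _)
      ((List.perm_ext_iff_of_nodup hnodupK (Finset.sort_nodup _ _)).mpr fun l => by
        rw [hmemK, Finset.mem_sort])
  have hLg : L.map (g ∘ Prod.fst) = L.map id := List.map_congr_left fun x hx => by
    obtain ⟨e, -, rfl⟩ := hmem x hx
    have he : (Finsupp.equivFunOnFinite.symm fun i : Fin n =>
        (List.ofFn fun i : Fin n => e i).getD i.val 0) = e := by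
      ext i; simp
    simp only [Function.comp_apply, hg, he, id]
  rw [hdl, ← hKS, hK, List.map_map, hLg, List.map_id]

end Lex

/-! ### The dense representation of `P'_d` as an explicit list -/

section Dense

variable {k : ℕ}

/-- Lists of length `k` are recovered from their default-readings. [folklore] -/
private theorem ofFn_getD_eq {l : List ℕ} {k : ℕ} (hl : l.length = k) :
    (List.ofFn fun i : Fin k => l.getD i 0) = l := by
  subst hl
  refine List.ext_getElem (by simp) fun i h₁ h₂ => ?_
  rw [List.getElem_ofFn, List.getD_eq_getElem _ _ h₂]

/-- A nonzero kernel coefficient certifies a singular prefix containing its index. [cite: GuoKumarSaptharishiSolomon2019, Thm 15 (arXiv p0009.txt:L47-48), proof step] -/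
theorem lt_of_kerCoeff_ne_zero {k s : ℕ} {H : List (List ℚ)} {i : ℕ} (h : kerCoeff k s H i ≠ 0) :
    i < firstSing k s H ∧ firstSing k s H ≤ (s + 1) ^ k := by
  by_contra hc
  rw [kerCoeff, dif_neg hc] at h
  exact h rfl

/-- The `i`-th exponent list (`i < (s+1)^k`) is the `i`-th grid list. [cite: GuoKumarSaptharishiSolomon2019, §3.2–§3.3 (arXiv p0013.txt:L24-27, L57-60), proof step] -/
theorem ofFn_expVec {k s i : ℕ} (hi : i < (s + 1) ^ k) :
    List.ofFn (expVec k s i) = (gridLists k (s + 1))[i]'(by rw [length_gridLists]; exact hi) := by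
  have hi' : i < (gridLists k (s + 1)).length := by rw [length_gridLists]; exact hi
  have hlen := (mem_gridLists.mp (List.getElem_mem hi')).1
  unfold expVec
  rw [List.getD_eq_getElem _ _ hi']
  exact ofFn_getD_eq hlen

/-- **The indices of the support of `P_s`**, increasing: `i < j*` with `x_i ≠ 0`. [cite: GuoKumarSaptharishiSolomon2019, §3.3 (arXiv p0013.txt:L56 – p0014.txt:L8), proof step] -/
def suppIdx (k s : ℕ) (H : List (List ℚ)) : List ℕ :=
  (List.range (firstSing k s H)).filter fun i => decide (kerCoeff k s H i ≠ 0)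

/-- **The dense list of `P'_d`**: the monomials `z_1^{e_i 1} ⋯ z_k^{e_i k}` of `P_{s(d)}` with
nonzero coefficient `x_i` (exponent list `0 :: e_i`, coefficient `x_i / 1`), in increasing `i`,
followed by the padding monomial `z_0^d` (exponent list `d :: 0^k`, coefficient `1 / 1`).
[cite: GuoKumarSaptharishiSolomon2019, Question 4 footnote and §3.3 (arXiv p0005.txt:L2 "P_d as a sum of monomials", p0014.txt:L5 "explicit family")] -/
def bootDense (k : ℕ) (H₀ : ℕ → List (List ℚ)) (d : ℕ) : List (List ℕ × (ℤ × ℕ)) :=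
  (suppIdx k (sOf k d) (H₀ (sOf k d))).map (fun i =>
      (0 :: (gridLists k (sOf k d + 1)).getD i [], (kerCoeff k (sOf k d) (H₀ (sOf k d)) i, 1))) ++
    [(d :: List.replicate k 0, (1, 1))]

/-- The exponent of a moved monomial: `mapDomain succ e = (0, e)`. [folklore] -/
private theorem ofFn_mapDomain_succ (e : Fin k →₀ ℕ) :
    (List.ofFn (Finsupp.mapDomain Fin.succ e) : List ℕ) = 0 :: List.ofFn e := by
  rw [List.ofFn_succ]
  congr 1
  · exact Finsupp.mapDomain_notin_range _ _ (by simp)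
  · exact List.ofFn_inj.mpr (funext fun i => Finsupp.mapDomain_apply (Fin.succ_injective k) _ _)

/-- The exponent of the padding monomial: `single 0 d = (d, 0, …, 0)`. [folklore] -/
private theorem ofFn_single_zero (d : ℕ) :
    (List.ofFn (Finsupp.single (0 : Fin (k + 1)) d) : List ℕ) = d :: List.replicate k 0 := by
  rw [List.ofFn_succ, Finsupp.single_eq_same]
  congr 1
  rw [← List.ofFn_const k 0]
  congr 1
  funext i
  exact Finsupp.single_eq_of_ne (Fin.succ_ne_zero i)

/-- Coefficients of `P'_d` at moved exponents are the kernel coefficients. [cite: GuoKumarSaptharishiSolomon2019, §3.3 (arXiv p0013.txt:L56 – p0014.txt:L8), proof step] -/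
theorem coeff_bootFamily_mapDomain (H₀ : ℕ → List (List ℚ)) {d : ℕ} (hd : 1 ≤ d) {i : ℕ}
    (hi : i < (sOf k d + 1) ^ k) :
    coeff (Finsupp.mapDomain Fin.succ (expFinsupp k (sOf k d) i)) (bootFamily k H₀ d) =
      (kerCoeff k (sOf k d) (H₀ (sOf k d)) i : ℚ) := by
  classical
  rw [bootFamily, coeff_add, X_pow_eq_monomial, coeff_monomial, if_neg, zero_add,
    coeff_rename_mapDomain _ (Fin.succ_injective k), coeff_vanishingPoly _ hi]
  intro h
  have := congrArg (fun f => f 0) h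
  simp only [Finsupp.single_eq_same] at this
  rw [Finsupp.mapDomain_notin_range _ _ (by simp)] at this
  omega

/-- The coefficient of the padding monomial is `1`. [cite: GuoKumarSaptharishiSolomon2019, §3.3 (arXiv p0013.txt:L56 – p0014.txt:L8), proof step] -/
theorem coeff_bootFamily_single (H₀ : ℕ → List (List ℚ)) {d : ℕ} (hd : 1 ≤ d) :
    coeff (Finsupp.single (0 : Fin (k + 1)) d) (bootFamily k H₀ d) = 1 := by
  classical
  rw [bootFamily, coeff_add, X_pow_eq_monomial, coeff_monomial, if_pos rfl, coeff_rename_eq_zero,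
    add_zero]
  intro u hu
  exfalso
  have := congrArg (fun f => f 0) hu
  simp only [Finsupp.single_eq_same] at this
  rw [Finsupp.mapDomain_notin_range _ _ (by simp)] at this
  omega

/-- Every monomial of `P'_d` is the padding monomial or a moved monomial of `P_{s(d)}` with nonzero
kernel coefficient. [cite: GuoKumarSaptharishiSolomon2019, §3.3 (arXiv p0013.txt:L56 – p0014.txt:L8), proof step] -/
theorem mem_support_bootFamily (H₀ : ℕ → List (List ℚ)) {d : ℕ} {m : Fin (k + 1) →₀ ℕ}
    (hm : m ∈ (bootFamily k H₀ d).support) :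
    m = Finsupp.single 0 d ∨ ∃ i, i < firstSing k (sOf k d) (H₀ (sOf k d)) ∧ i < (sOf k d + 1) ^ k ∧
      m = Finsupp.mapDomain Fin.succ (expFinsupp k (sOf k d) i) ∧
      kerCoeff k (sOf k d) (H₀ (sOf k d)) i ≠ 0 := by
  classical
  rw [bootFamily] at hm
  rcases Finset.mem_union.mp (support_add hm) with h | h
  · left
    rw [X_pow_eq_monomial] at h
    exact Finset.mem_singleton.mp (support_monomial_subset h)
  · right
    have hne := mem_support_iff.mp h
    obtain ⟨u, hu, hcu⟩ : ∃ u, Finsupp.mapDomain Fin.succ u = m ∧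
        coeff u (vanishingPoly k (sOf k d) (H₀ (sOf k d))) ≠ 0 := by
      by_contra hc
      push Not at hc
      exact hne (coeff_rename_eq_zero _ _ _ hc)
    obtain ⟨i, hiJ, hiN, hui, hki⟩ := exists_of_mem_support_vanishingPoly (mem_support_iff.mpr hcu)
    exact ⟨i, hiJ, hiN, by rw [← hu, hui], hki⟩

/-- **`denseList (P'_d) = bootDense d`** (`d ≥ 1`): the dense representation of the padded family is
the explicit list. [cite: GuoKumarSaptharishiSolomon2019, Question 4 footnote and §3.3 (arXiv p0005.txt:L2, p0014.txt:L5)] -/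
theorem denseList_bootFamily (H₀ : ℕ → List (List ℚ)) {d : ℕ} (hd : 1 ≤ d) :
    denseList (bootFamily k H₀ d) = bootDense k H₀ d := by
  classical
  set s := sOf k d with hs
  set H := H₀ s with hH
  set G := gridLists k (s + 1) with hG
  have hGlen : G.length = (s + 1) ^ k := length_gridLists k (s + 1)
  -- facts about the listed indices
  have hidx : ∀ i ∈ suppIdx k s H, i < firstSing k s H ∧ i < (s + 1) ^ k ∧ kerCoeff k s H i ≠ 0 := by
    intro i hi
    rw [suppIdx, List.mem_filter, decide_eq_true_eq] at hi
    obtain ⟨h1, h2⟩ := lt_of_kerCoeff_ne_zero hi.2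
    exact ⟨h1, lt_of_lt_of_le h1 h2, hi.2⟩
  have hkey : ∀ i, i < (s + 1) ^ k →
      (0 :: G.getD i [] : List ℕ) = List.ofFn (Finsupp.mapDomain Fin.succ (expFinsupp k s i)) := by
    intro i hi
    rw [ofFn_mapDomain_succ]
    congr 1
    have h1 : (List.ofFn (expFinsupp k s i) : List ℕ) = List.ofFn (expVec k s i) :=
      List.ofFn_inj.mpr (funext fun t => expFinsupp_apply k s i t)
    rw [h1, ofFn_expVec hi, List.getD_eq_getElem _ _ (by rw [hGlen]; exact hi)]
  refine denseList_eq_of _ _ ?_ ?_ ?_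
  · -- keys strictly increasing
    rw [bootDense, List.map_append, List.map_map, List.pairwise_append]
    refine ⟨?_, by simp, ?_⟩
    · rw [List.pairwise_map]
      have hP : (suppIdx k s H).Pairwise (· < ·) := List.pairwise_lt_range.filter _
      refine hP.imp_of_mem fun {i j} hi hj hij => ?_
      obtain ⟨-, hiN, -⟩ := hidx i hi
      obtain ⟨-, hjN, -⟩ := hidx j hj
      simp only [Function.comp_apply]
      refine List.Lex.cons ?_
      rw [List.getD_eq_getElem _ _ (by rw [hGlen]; exact hiN),
        List.getD_eq_getElem _ _ (by rw [hGlen]; exact hjN)]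
      exact List.pairwise_iff_getElem.mp (pairwise_lex_gridLists k (s + 1)) i j _ _ hij
    · intro x hx y hy
      obtain ⟨i, -, rfl⟩ := List.mem_map.mp hx
      simp only [List.map_cons, List.map_nil, List.mem_singleton] at hy
      subst hy
      exact List.Lex.rel (by omega)
  · -- every entry is a genuine monomial with its coefficient
    intro x hx
    rw [bootDense, List.mem_append, List.mem_map, List.mem_singleton] at hx
    rcases hx with ⟨i, hi, rfl⟩ | rfl
    · obtain ⟨-, hiN, hki⟩ := hidx i hi
      refine ⟨Finsupp.mapDomain Fin.succ (expFinsupp k s i), mem_support_iff.mpr ?_, ?_⟩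
      · rw [hs, coeff_bootFamily_mapDomain H₀ hd hiN]; exact_mod_cast hki
      · rw [hkey i hiN, hs, coeff_bootFamily_mapDomain H₀ hd hiN]
        simp
    · refine ⟨Finsupp.single 0 d, mem_support_iff.mpr ?_, ?_⟩
      · rw [coeff_bootFamily_single H₀ hd]; exact one_ne_zero
      · rw [ofFn_single_zero, coeff_bootFamily_single H₀ hd]
        simp
  · -- the support is covered
    intro m hm
    rw [bootDense, List.map_append, List.mem_append, List.map_map]
    rcases mem_support_bootFamily H₀ hm with rfl | ⟨i, hiJ, hiN, rfl, hki⟩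
    · right; simp
    · left
      refine List.mem_map.mpr ⟨i, ?_, ?_⟩
      · rw [suppIdx, List.mem_filter, List.mem_range, decide_eq_true_eq]; exact ⟨hiJ, hki⟩
      · simp only [Function.comp_apply]; exact hkey i hiN

end Dense

/-! ### The construction as a list program (semantic level of the machine) -/

section Program

open Literature.Computability.Complexity Literature.Computability.Complexity.IntDetFP
open Literature.LinearAlgebra.Matrix.Berkowitz (rows getD_ofFn take_ofFn zipWith_ofFn)

variable {k : ℕ}

/-- The numerator/denominator list `[(num a_t, den a_t) | t < k]` of a point. [cite: GuoKumarSaptharishiSolomon2019, §1.2 (arXiv p0006.txt:L28, poly-time enumeration), program step] -/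
def ndRow (k : ℕ) (a : List ℚ) : List (ℤ × ℕ) :=
  (List.range k).map fun t => ((a.getD t 0).num, (a.getD t 0).den)

/-- The scaled integer value `∏_t num_t^{x_t} den_t^{s - x_t}` from the numerator/denominator list
and an exponent list (exponents capped at `s`, a no-op on `{0..s}^k`, so that the machine's powers
have unary budgets). [cite: GuoKumarSaptharishiSolomon2019, Thm 15 (arXiv p0009.txt:L47-48), program step] -/
def entryP (s : ℕ) (nd : List (ℤ × ℕ)) (e : List ℕ) : ℤ :=
  (List.zipWith (fun (p : ℤ × ℕ) (x : ℕ) => p.1 ^ min x s * (p.2 : ℤ) ^ (s - x)) nd e).prod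

/-- The evaluation TABLE: one row per point, one column per exponent vector of `{0..s}^k`.
[cite: GuoKumarSaptharishiSolomon2019, Thm 15 (arXiv p0009.txt:L47-48), program step] -/
def tableP (k s : ℕ) (H : List (List ℚ)) : List (List ℤ) :=
  H.map fun a => (gridLists k (s + 1)).map fun e => entryP s (ndRow k a) e

/-- The rows of the Gram matrix of the first `j` columns of a table. [cite: GuoKumarSaptharishiSolomon2019, Thm 15 (arXiv p0009.txt:L47-48), program step] -/
def gramP (T : List (List ℤ)) (j : ℕ) : List (List ℤ) :=
  (List.range j).map fun u => (List.range j).map fun v =>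
    (T.map fun row : List ℤ => row.getD u 0 * row.getD v 0).sum

/-- The first singular prefix, by the polynomial-time determinant `detZ`. [cite: GuoKumarSaptharishiSolomon2019, Thm 15 (arXiv p0009.txt:L47-48), program step] -/
def firstSingP (N : ℕ) (T : List (List ℤ)) : ℕ :=
  (List.range (N + 1)).findIdx fun j => decide (0 < j ∧ detZ (gramP T j) = 0)

/-- The unit row `e_i` of length `J` (the replaced last row in Mathlib's `adjugate_apply`). [cite: GuoKumarSaptharishiSolomon2019, Thm 15 (arXiv p0009.txt:L47-48), program step] -/
def unitRowP (J i : ℕ) : List ℤ := (List.range J).map fun v => if v = i then 1 else 0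

/-- The adjugate entry `adj(Gram_J)_{i, J-1} = det(Gram_J with its last row replaced by e_i)`, by
`detZ`. [cite: GuoKumarSaptharishiSolomon2019, Thm 15 (arXiv p0009.txt:L47-48), program step] -/
def adjP (T : List (List ℤ)) (J i : ℕ) : ℤ :=
  detZ ((gramP T J).take (J - 1) ++ [unitRowP J i])

/-- The kernel coefficients, program form. [cite: GuoKumarSaptharishiSolomon2019, Thm 15 (arXiv p0009.txt:L47-48), program step] -/
def kerCoeffP (N : ℕ) (T : List (List ℤ)) (i : ℕ) : ℤ :=
  if i < firstSingP N T ∧ firstSingP N T ≤ N then adjP T (firstSingP N T) i else 0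

/-- The dense list of `P'_d`, program form (for `d ≥ 1`). [cite: GuoKumarSaptharishiSolomon2019, Question 4 footnote and §3.3 (arXiv p0005.txt:L2, p0014.txt:L5), program step] -/
def bootDenseP (k : ℕ) (H₀ : ℕ → List (List ℚ)) (d : ℕ) : List (List ℕ × (ℤ × ℕ)) :=
  ((List.range (firstSingP ((sOf k d + 1) ^ k) (tableP k (sOf k d) (H₀ (sOf k d))))).filter fun i =>
      decide (kerCoeffP ((sOf k d + 1) ^ k) (tableP k (sOf k d) (H₀ (sOf k d))) i ≠ 0)).map
      (fun i => (0 :: (gridLists k (sOf k d + 1)).getD i [],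
        (kerCoeffP ((sOf k d + 1) ^ k) (tableP k (sOf k d) (H₀ (sOf k d))) i, 1))) ++
    [(d :: List.replicate k 0, (1, 1))]

/-! #### The program computes the construction -/

/-- `findIdx` only depends on the predicate on the members of the list. [folklore] -/
private theorem findIdx_congr {α : Type*} {p q : α → Bool} :
    ∀ {l : List α}, (∀ a ∈ l, p a = q a) → l.findIdx p = l.findIdx q
  | [], _ => rfl
  | a :: l, h => by
    rw [List.findIdx_cons, List.findIdx_cons, h a (List.mem_cons_self ..),
      findIdx_congr fun b hb => h b (List.mem_cons_of_mem _ hb)]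

/-- The numerator/denominator list as `List.ofFn`. [folklore] -/
private theorem ndRow_eq_ofFn (k : ℕ) (a : List ℚ) :
    ndRow k a = List.ofFn fun t : Fin k => ((ptOf k a t).num, (ptOf k a t).den) := by
  refine List.ext_getElem (by simp [ndRow]) fun t h₁ h₂ => ?_
  simp [ndRow, ptOf]

/-- **The table entries are the scaled integer values.** [cite: GuoKumarSaptharishiSolomon2019, Thm 15 (arXiv p0009.txt:L47-48), program step] -/
theorem entryP_eq (s : ℕ) (a : List ℚ) {i : ℕ} (hi : i < (s + 1) ^ k) :
    entryP s (ndRow k a) ((gridLists k (s + 1))[i]'(by rw [length_gridLists]; exact hi)) =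
      scaledEval s (ptOf k a) (expVec k s i) := by
  rw [entryP, ndRow_eq_ofFn, ← ofFn_expVec hi, zipWith_ofFn, List.prod_ofFn, scaledEval]
  exact Finset.prod_congr rfl fun t _ => by rw [min_eq_left (expVec_le k s i t)]

/-- **The table is the row list of the full evaluation matrix.** [cite: GuoKumarSaptharishiSolomon2019, Thm 15 (arXiv p0009.txt:L47-48), program step] -/
theorem tableP_eq (k s : ℕ) (H : List (List ℚ)) :
    tableP k s H = rows (evalMatrix k s H ((s + 1) ^ k)) := by
  refine List.ext_getElem (by simp [tableP, rows]) fun a h₁ h₂ => ?_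
  simp only [tableP, rows, List.getElem_map, List.getElem_ofFn]
  refine List.ext_getElem (by simp [length_gridLists]) fun i h₁' h₂' => ?_
  simp only [List.getElem_map, List.getElem_ofFn]
  have hi : i < (s + 1) ^ k := by simpa [length_gridLists] using h₁'
  exact entryP_eq s _ hi

/-- **The Gram rows of the table are the rows of the Gram matrices.** [cite: GuoKumarSaptharishiSolomon2019, Thm 15 (arXiv p0009.txt:L47-48), program step] -/
theorem gramP_eq (k s : ℕ) (H : List (List ℚ)) {j : ℕ} (hj : j ≤ (s + 1) ^ k) :
    gramP (tableP k s H) j = rows (gram k s H j) := by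
  rw [tableP_eq]
  refine List.ext_getElem (by simp [gramP, rows]) fun u h₁ h₂ => ?_
  have hu : u < j := by simpa [gramP] using h₁
  simp only [gramP, rows, List.getElem_map, List.getElem_range, List.getElem_ofFn]
  refine List.ext_getElem (by simp) fun v h₁' h₂' => ?_
  have hv : v < j := by simpa using h₁'
  simp only [List.getElem_map, List.getElem_range, List.getElem_ofFn]
  rw [List.map_ofFn, List.sum_ofFn]
  unfold gram
  rw [Matrix.mul_apply]
  refine Finset.sum_congr rfl fun a _ => ?_
  simp only [Function.comp_apply, Matrix.transpose_apply]
  rw [getD_ofFn, dif_pos (by omega), getD_ofFn, dif_pos (by omega)]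
  rfl

/-- `detZ` of the Gram rows is the Gram determinant. [cite: GuoKumarSaptharishiSolomon2019, Thm 15 (arXiv p0009.txt:L47-48), program step] -/
theorem detZ_gramP (k s : ℕ) (H : List (List ℚ)) {j : ℕ} (hj : j ≤ (s + 1) ^ k) :
    detZ (gramP (tableP k s H) j) = gramDet k s H j := by
  rw [gramP_eq k s H hj, detZ_rows, gramDet]

/-- **The program finds the first singular prefix.** [cite: GuoKumarSaptharishiSolomon2019, Thm 15 (arXiv p0009.txt:L47-48), program step] -/
theorem firstSingP_eq (k s : ℕ) (H : List (List ℚ)) :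
    firstSingP ((s + 1) ^ k) (tableP k s H) = firstSing k s H := by
  rw [firstSingP, firstSing]
  refine findIdx_congr fun j hj => ?_
  rw [detZ_gramP k s H (Nat.le_of_lt_succ (List.mem_range.mp hj))]

/-- The unit row is `Pi.single`. [folklore] -/
private theorem unitRowP_eq {m : ℕ} (i : Fin (m + 1)) :
    unitRowP (m + 1) i = List.ofFn (Pi.single i (1 : ℤ) : Fin (m + 1) → ℤ) := by
  refine List.ext_getElem (by simp [unitRowP]) fun v h₁ h₂ => ?_
  simp only [unitRowP, List.getElem_map, List.getElem_range, List.getElem_ofFn, Pi.single_apply,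
    Fin.ext_iff]

/-- Replacing the last row, on row lists. [folklore] -/
private theorem rows_updateRow_last {m : ℕ} (A : Matrix (Fin (m + 1)) (Fin (m + 1)) ℤ)
    (r : Fin (m + 1) → ℤ) :
    rows (A.updateRow (Fin.last m) r) = (rows A).take m ++ [List.ofFn r] := by
  rw [rows, rows, take_ofFn _ (Nat.le_succ m), List.ofFn_succ', List.concat_eq_append,
    Matrix.updateRow_self]
  congr 1
  refine List.ofFn_inj.mpr (funext fun i => ?_)
  rw [Matrix.updateRow_ne (Fin.castSucc_lt_last i).ne]
  rfl

/-- **The program computes the adjugate column**: for `J = m+1 ≤ (s+1)^k` and `i < J`,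
`adjP T J i = adj(Gram_J)_{i,m}`. [cite: GuoKumarSaptharishiSolomon2019, Thm 15 (arXiv p0009.txt:L47-48), program step] -/
theorem adjP_eq (k s : ℕ) (H : List (List ℚ)) {m : ℕ} (hJ : m + 1 ≤ (s + 1) ^ k) (i : Fin (m + 1)) :
    adjP (tableP k s H) (m + 1) i = adjCol k s H m i := by
  rw [adjP, gramP_eq k s H hJ, Nat.add_sub_cancel, unitRowP_eq, ← rows_updateRow_last, detZ_rows,
    adjCol, Matrix.adjugate_apply]

/-- Reindexing the adjugate column along an equality of sizes. [folklore] -/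
private theorem adjCol_congr' (k s : ℕ) (H : List (List ℚ)) {n m : ℕ} (h : n = m) (i : ℕ) (hi : i < n + 1) :
    adjCol k s H n ⟨i, hi⟩ = adjCol k s H m ⟨i, by omega⟩ := by
  subst h; rfl

/-- **The program computes the kernel coefficients.** [cite: GuoKumarSaptharishiSolomon2019, Thm 15 (arXiv p0009.txt:L47-48), program step] -/
theorem kerCoeffP_eq (k s : ℕ) (H : List (List ℚ)) (i : ℕ) :
    kerCoeffP ((s + 1) ^ k) (tableP k s H) i = kerCoeff k s H i := by
  rw [kerCoeffP, kerCoeff, firstSingP_eq]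
  by_cases h : i < firstSing k s H ∧ firstSing k s H ≤ (s + 1) ^ k
  · rw [if_pos h, dif_pos h]
    obtain ⟨m, hm⟩ : ∃ m, firstSing k s H = m + 1 := ⟨firstSing k s H - 1, by omega⟩
    have hi : i < m + 1 := by omega
    rw [adjCol_congr' k s H (show firstSing k s H - 1 = m by omega) i (by omega)]
    have h1 := adjP_eq k s H (m := m) (by omega) ⟨i, hi⟩
    have h2 : adjP (tableP k s H) (firstSing k s H) i = adjP (tableP k s H) (m + 1) i := by rw [hm]
    rw [h2]
    exact h1
  · rw [if_neg h, dif_neg h]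

/-- **The program computes the dense list of `P'_d`.** [cite: GuoKumarSaptharishiSolomon2019, Question 4 footnote and §3.3 (arXiv p0005.txt:L2, p0014.txt:L5), program step] -/
theorem bootDenseP_eq (k : ℕ) (H₀ : ℕ → List (List ℚ)) (d : ℕ) : bootDenseP k H₀ d = bootDense k H₀ d := by
  rw [bootDenseP, bootDense, suppIdx, firstSingP_eq]
  simp only [kerCoeffP_eq]

end Program

/-! ### The program on codes (typed `CodeFP` combinators; no machine written) -/

section Code

open _root_.Computability Literature.Computability.Complexity
open Literature.Computability.Complexity.CodeFP Literature.Computability.Complexity.IntDetFP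
open Literature.Algebra.EuclideanLattices (encodeRat)

variable {σ : Type} {eσ : σ → List Bool}

/-- The multiplying fold. [folklore] -/
private theorem foldl_mul_eq_prod_int (l : List ℤ) (acc : ℤ) :
    l.foldl (fun acc a => acc * a) acc = acc * l.prod := by
  induction l generalizing acc with
  | nil => simp
  | cons a l ih => rw [List.foldl_cons, ih, List.prod_cons]; ring

/-- `size (∏ l) ≤ Σ size + 1`. [folklore] -/
private theorem size_list_prod_le (L : List ℕ) : Nat.size L.prod ≤ (L.map Nat.size).sum + 1 := by
  induction L with
  | nil => simp
  | cons a L ih =>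
    rw [List.prod_cons, List.map_cons, List.sum_cons]
    exact (size_mul_le a L.prod).trans (by omega)

/-- `|∏ l| = ∏ |l|`. [folklore] -/
private theorem natAbs_prod (l : List ℤ) : l.prod.natAbs = (l.map Int.natAbs).prod := by
  induction l with
  | nil => simp
  | cons a l ih => rw [List.prod_cons, Int.natAbs_mul, ih, List.map_cons, List.prod_cons]

/-- **Products of raw lists of integers** (the code of the product is no longer than the code of the
list, up to constants; same statement and proof as `SumcheckMAReferee.intProd`, copied to keep the
import closure small). [cite: AroraBarak2009, §1.3 (polynomially bounded loops)] -/
private theorem intProd : CodeFP (rawE intE) intE List.prod := by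
  have hstep : CodeFP (pairE intE intE) intE (fun t => t.2 * t.1) := (intMul.comp ((snd _ _).pair (fst _ _)) :)
  have h := foldl₀ (step := fun (a : ℤ) acc => acc * a) (b₀ := 1) hstep
    (3 * Polynomial.X + 6) (fun l₁ l₂ => by
      rw [foldl_mul_eq_prod_int, one_mul]
      simp only [Polynomial.eval_add, Polynomial.eval_mul, Polynomial.eval_X, Polynomial.eval_ofNat]
      set L := (rawE intE (l₁ ++ l₂)).length
      have hsum : ((l₁.map Int.natAbs).map Nat.size).sum ≤ L := by
        rw [List.map_map]
        have h1 : ((l₁ ++ l₂).map fun a => 2 * (intE a).length + 2).sum = L :=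
          (length_rawE intE (l₁ ++ l₂)).symm
        have h2 : (l₁.map (Nat.size ∘ Int.natAbs)).sum ≤ (l₁.map fun a => 2 * (intE a).length + 2).sum :=
          List.sum_le_sum fun z _ => by
            have := size_natAbs_le_length_intE z
            simp only [Function.comp_apply]; omega
        have h3 : (l₁.map fun a => 2 * (intE a).length + 2).sum ≤
            ((l₁ ++ l₂).map fun a => 2 * (intE a).length + 2).sum := by
          rw [List.map_append, List.sum_append]; omega
        omega
      have h1 := Brick.length_dpEnc_le l₁.prod
      have h2 : Nat.size l₁.prod.natAbs ≤ L + 1 := by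
        rw [natAbs_prod]
        exact (size_list_prod_le _).trans (by omega)
      change (Brick.dpEnc l₁.prod).length ≤ _
      omega)
  exact h.congr fun l => by rw [foldl_mul_eq_prod_int, one_mul]

/-- **The numerator/denominator list on codes** (`k` a constant). [cite: AroraBarak2009, §1.3] -/
theorem ndRowFP (k : ℕ) : CodeFP (rawE encodeRat) (rawE (pairE intE natE)) (ndRow k) := by
  let ctx : List ℚ × ℕ → List Bool := pairE (rawE encodeRat) natE
  -- (compositions with `rawGetOr` are elaborated bottom-up, WITHOUT expected types: stating the
  -- intermediate functions makes the unifier time out)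
  have hq := (rawGetOr encodeRat).comp ((fst (rawE encodeRat) natE).pair
    ((snd (rawE encodeRat) natE).pair (const ctx (0 : ℚ))))
  have hitem := ratNumDen.comp hq
  have h := (CodeFP.map (σ := List ℚ) (eσ := rawE encodeRat)
    (g := fun c : List ℚ × ℕ => ((c.1.getD c.2 0).num, (c.1.getD c.2 0).den)) hitem).comp
    ((CodeFP.id (rawE encodeRat)).pair (const _ (List.range k)))
  exact h.congr fun a => rfl

/-- **A table entry on codes** (context: `s` in unary, the numerator/denominator list, the
exponent list; powers through unary exponents `≤ s`). [cite: AroraBarak2009, §1.3] -/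
theorem entryFP {sf : σ → ℕ} {ndf : σ → List (ℤ × ℕ)} {ef : σ → List ℕ} (hus : CodeFP eσ unE sf)
    (hnd : CodeFP eσ (rawE (pairE intE natE)) ndf) (he : CodeFP eσ (rawE natE) ef) :
    CodeFP eσ intE (fun c => entryP (sf c) (ndf c) (ef c)) := by
  let ctx : σ × ((ℤ × ℕ) × ℕ) → List Bool := pairE eσ (pairE (pairE intE natE) natE)
  have cs : CodeFP ctx unE (fun c => sf c.1) := hus.comp (fst _ _)
  have cnum : CodeFP ctx intE (fun c => c.2.1.1) := (snd _ _).fst'.fst'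
  have cden : CodeFP ctx intE (fun c => (c.2.1.2 : ℤ)) := intOfNat.comp (snd _ _).fst'.snd'
  have cx : CodeFP ctx natE (fun c => c.2.2) := (snd _ _).snd'
  have cux : CodeFP ctx unE (fun c => min c.2.2 (sf c.1)) := unOfNatMin.comp (cs.pair cx)
  have cusx : CodeFP ctx unE (fun c => min (sf c.1 - c.2.2) (sf c.1)) :=
    unOfNatMin.comp (cs.pair (natSub.comp ((natOfUn.comp cs).pair cx)))
  have citem : CodeFP ctx intE (fun c => c.2.1.1 ^ min c.2.2 (sf c.1) * (c.2.1.2 : ℤ) ^ (sf c.1 - c.2.2)) :=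
    (intMul.comp ((intPow.comp (cnum.pair cux)).pair (intPow.comp (cden.pair cusx)))).congr
      fun c => by rw [min_eq_left (Nat.sub_le _ _)]
  have h := intProd.comp ((zipWith (σ := σ) (eσ := eσ)
    (g := fun c : σ × ((ℤ × ℕ) × ℕ) => c.2.1.1 ^ min c.2.2 (sf c.1) * (c.2.1.2 : ℤ) ^ (sf c.1 - c.2.2))
    citem).comp ((CodeFP.id eσ).pair (hnd.pair he)))
  exact h.congr fun c => rfl

/-- **The evaluation table on codes** (context: `s` in unary and binary, the point list).
[cite: AroraBarak2009, §1.3] -/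
theorem tableFP (k : ℕ) {sf : σ → ℕ} {Hf : σ → List (List ℚ)} (hus : CodeFP eσ unE sf)
    (hns : CodeFP eσ natE sf) (hH : CodeFP eσ (rawE (rawE encodeRat)) Hf) :
    CodeFP eσ (rawE (rawE intE)) (fun c => tableP k (sf c) (Hf c)) := by
  have hG : CodeFP eσ (rawE (rawE natE)) (fun c => gridLists k (sf c + 1)) :=
    gridListsFP (unSucc.comp hus) ((natAdd.comp (hns.pair (const _ 1))).congr fun _ => rfl) k
  let ctx : σ × List ℚ → List Bool := pairE eσ (rawE encodeRat)
  have cnd : CodeFP ctx (rawE (pairE intE natE)) (fun c => ndRow k c.2) := (ndRowFP k).comp (snd _ _)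
  let ctx2 : (σ × List ℚ) × List ℕ → List Bool := pairE ctx (rawE natE)
  have citem : CodeFP ctx2 intE (fun c => entryP (sf c.1.1) (ndRow k c.1.2) c.2) :=
    entryFP (sf := fun c : (σ × List ℚ) × List ℕ => sf c.1.1) (ndf := fun c => ndRow k c.1.2)
      (ef := fun c => c.2) (hus.comp (fst _ _).fst') (cnd.comp (fst _ _)) (snd _ _)
  have crow : CodeFP ctx (rawE intE)
      (fun c => (gridLists k (sf c.1 + 1)).map fun e => entryP (sf c.1) (ndRow k c.2) e) :=
    ((CodeFP.map (σ := σ × List ℚ) (eσ := ctx)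
      (g := fun c : (σ × List ℚ) × List ℕ => entryP (sf c.1.1) (ndRow k c.1.2) c.2) citem).comp
      ((CodeFP.id ctx).pair (hG.comp (fst _ _)))).congr fun c => rfl
  have h := (CodeFP.map (σ := σ) (eσ := eσ)
    (g := fun c : σ × List ℚ => (gridLists k (sf c.1 + 1)).map fun e => entryP (sf c.1) (ndRow k c.2) e)
    crow).comp ((CodeFP.id eσ).pair hH)
  exact h.congr fun c => rfl

/-- **The Gram rows on codes** (context: the table and `j` in unary). [cite: AroraBarak2009, §1.3] -/
theorem gramFP {Tf : σ → List (List ℤ)} {jf : σ → ℕ} (hT : CodeFP eσ (rawE (rawE intE)) Tf)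
    (huj : CodeFP eσ unE jf) : CodeFP eσ (rawE (rawE intE)) (fun c => gramP (Tf c) (jf c)) := by
  have hrange : CodeFP eσ (rawE natE) (fun c => List.range (jf c)) := urange.comp huj
  let ctx : (σ × ℕ) × ℕ → List Bool := pairE (pairE eσ natE) natE
  let ctx3 : ((σ × ℕ) × ℕ) × List ℤ → List Bool := pairE ctx (rawE intE)
  have cu : CodeFP ctx3 natE (fun c => c.1.1.2) := (fst _ _).fst'.snd'
  have cv : CodeFP ctx3 natE (fun c => c.1.2) := (fst _ _).snd'
  have crow : CodeFP ctx3 (rawE intE) (fun c => c.2) := snd _ _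
  have cgu := (rawGetOr intE).comp (crow.pair (cu.pair (const ctx3 (0 : ℤ))))
  have cgv := (rawGetOr intE).comp (crow.pair (cv.pair (const ctx3 (0 : ℤ))))
  have cprod := intMul.comp (cgu.pair cgv)
  have centry : CodeFP ctx intE
      (fun c => ((Tf c.1.1).map fun row : List ℤ => row.getD c.1.2 0 * row.getD c.2 0).sum) :=
    (intSum.comp ((CodeFP.map (σ := (σ × ℕ) × ℕ) (eσ := ctx)
      (g := fun c : ((σ × ℕ) × ℕ) × List ℤ => c.2.getD c.1.1.2 0 * c.2.getD c.1.2 0) cprod).comp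
      ((CodeFP.id ctx).pair (hT.comp (fst _ _).fst')))).congr fun c => rfl
  have crowu : CodeFP (pairE eσ natE) (rawE intE) (fun c => (List.range (jf c.1)).map fun v =>
      ((Tf c.1).map fun row : List ℤ => row.getD c.2 0 * row.getD v 0).sum) :=
    ((CodeFP.map (σ := σ × ℕ) (eσ := pairE eσ natE)
      (g := fun c : (σ × ℕ) × ℕ => ((Tf c.1.1).map fun row : List ℤ => row.getD c.1.2 0 * row.getD c.2 0).sum)
      centry).comp ((CodeFP.id _).pair (hrange.comp (fst _ _)))).congr fun c => rfl
  have h := (CodeFP.map (σ := σ) (eσ := eσ)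
    (g := fun c : σ × ℕ => (List.range (jf c.1)).map fun v =>
      ((Tf c.1).map fun row : List ℤ => row.getD c.2 0 * row.getD v 0).sum) crowu).comp
    ((CodeFP.id eσ).pair hrange)
  exact h.congr fun c => rfl

/-- **The first singular prefix on codes** (context: the table, `N + 1` in unary).
[cite: AroraBarak2009, §1.3] -/
theorem firstSingFP {Tf : σ → List (List ℤ)} {Nf : σ → ℕ} (hT : CodeFP eσ (rawE (rawE intE)) Tf)
    (huN : CodeFP eσ unE (fun c => Nf c + 1)) :
    CodeFP eσ natE (fun c => firstSingP (Nf c) (Tf c)) := by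
  let ctx : σ × ℕ → List Bool := pairE eσ natE
  have cuj : CodeFP ctx unE (fun c => min c.2 (Nf c.1 + 1)) :=
    unOfNatMin.comp ((huN.comp (fst _ _)).pair (snd _ _))
  have cgram : CodeFP ctx (rawE (rawE intE)) (fun c => gramP (Tf c.1) (min c.2 (Nf c.1 + 1))) :=
    gramFP (Tf := fun c : σ × ℕ => Tf c.1) (jf := fun c => min c.2 (Nf c.1 + 1)) (hT.comp (fst _ _)) cuj
  have cdet : CodeFP ctx bitE (fun c => decide (detZ (gramP (Tf c.1) (min c.2 (Nf c.1 + 1))) = 0)) :=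
    intEq.comp ((detZ_codeFP.comp cgram).pair (const _ (0 : ℤ)))
  have cpos : CodeFP ctx bitE (fun c => decide (0 < c.2)) := natLt.comp ((const _ 0).pair (snd _ _))
  have cp : CodeFP ctx bitE (fun c => decide (0 < c.2) &&
      decide (detZ (gramP (Tf c.1) (min c.2 (Nf c.1 + 1))) = 0)) := cpos.and cdet
  have h := (findIdxFP (σ := σ) (eσ := eσ) (p := fun c : σ × ℕ => decide (0 < c.2) &&
      decide (detZ (gramP (Tf c.1) (min c.2 (Nf c.1 + 1))) = 0)) cp).comp
    ((CodeFP.id eσ).pair (urange.comp huN))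
  refine h.congr fun c => ?_
  simp only [firstSingP, id]
  refine findIdx_congr fun j hj => ?_
  have hmin : min j (Nf c + 1) = j := min_eq_left (List.mem_range.mp hj).le
  simp only [hmin, Bool.decide_and]

/-- **An adjugate entry on codes** (context: the table, `J` in unary and binary, `i` in binary).
[cite: AroraBarak2009, §1.3] -/
theorem adjFP {Tf : σ → List (List ℤ)} {Jf i_f : σ → ℕ} (hT : CodeFP eσ (rawE (rawE intE)) Tf)
    (huJ : CodeFP eσ unE Jf) (hnJ : CodeFP eσ natE Jf) (hi : CodeFP eσ natE i_f) :
    CodeFP eσ intE (fun c => adjP (Tf c) (Jf c) (i_f c)) := by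
  have cgram : CodeFP eσ (rawE (rawE intE)) (fun c => gramP (Tf c) (Jf c)) := gramFP (Tf := Tf) (jf := Jf) hT huJ
  have ctake : CodeFP eσ (rawE (rawE intE)) (fun c => (gramP (Tf c) (Jf c)).take (Jf c - 1)) :=
    (rawTakeNat (rawE intE)).comp ((natSub.comp (hnJ.pair (const _ 1))).pair cgram)
  let ctx : σ × ℕ → List Bool := pairE eσ natE
  have cbit : CodeFP ctx bitE (fun c => decide (c.2 = i_f c.1)) :=
    natEq.comp ((snd _ _).pair (hi.comp (fst _ _)))
  have citem : CodeFP ctx intE (fun c => if decide (c.2 = i_f c.1) then (1 : ℤ) else 0) :=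
    cbit.ite (const _ (1 : ℤ)) (const _ (0 : ℤ))
  have cunit : CodeFP eσ (rawE intE) (fun c => unitRowP (Jf c) (i_f c)) :=
    ((CodeFP.map (σ := σ) (eσ := eσ) (g := fun c : σ × ℕ => if decide (c.2 = i_f c.1) then (1 : ℤ) else 0)
      citem).comp ((CodeFP.id eσ).pair (urange.comp huJ))).congr fun c => by
      simp only [unitRowP, id]
      refine List.map_congr_left fun v _ => ?_
      by_cases h : v = i_f c <;> simp [h]
  have h := detZ_codeFP.comp ((rawAppend (rawE intE)).comp (ctake.pair
    ((rawSingleton (rawE intE)).comp cunit)))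
  exact h.congr fun c => rfl

/-- **A kernel coefficient on codes** (context: the table, `N` in binary, `N + 1` in unary, `i`).
[cite: AroraBarak2009, §1.3] -/
theorem kerCoeffFP {Tf : σ → List (List ℤ)} {Nf i_f : σ → ℕ} (hT : CodeFP eσ (rawE (rawE intE)) Tf)
    (hN : CodeFP eσ natE Nf) (huN : CodeFP eσ unE (fun c => Nf c + 1)) (hi : CodeFP eσ natE i_f) :
    CodeFP eσ intE (fun c => kerCoeffP (Nf c) (Tf c) (i_f c)) := by
  have hJ : CodeFP eσ natE (fun c => firstSingP (Nf c) (Tf c)) := firstSingFP (Tf := Tf) (Nf := Nf) hT huN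
  have hJle : ∀ c, firstSingP (Nf c) (Tf c) ≤ Nf c + 1 := fun c => by
    have := List.findIdx_le_length (p := fun j => decide (0 < j ∧ detZ (gramP (Tf c) j) = 0))
      (xs := List.range (Nf c + 1))
    simpa [firstSingP] using this
  have huJ : CodeFP eσ unE (fun c => firstSingP (Nf c) (Tf c)) :=
    (unOfNatMin.comp (huN.pair hJ)).congr fun c => min_eq_left (hJle c)
  have hadj : CodeFP eσ intE (fun c => adjP (Tf c) (firstSingP (Nf c) (Tf c)) (i_f c)) :=
    adjFP (Tf := Tf) (Jf := fun c => firstSingP (Nf c) (Tf c)) (i_f := i_f) hT huJ hJ hi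
  have hbit : CodeFP eσ bitE (fun c => decide (i_f c < firstSingP (Nf c) (Tf c)) &&
      decide (firstSingP (Nf c) (Tf c) ≤ Nf c)) :=
    (natLt.comp (hi.pair hJ)).and (natLe.comp (hJ.pair hN))
  refine ((hbit.ite hadj (const _ (0 : ℤ))).congr fun c => ?_)
  rw [kerCoeffP, ← Bool.decide_and]
  by_cases h : i_f c < firstSingP (Nf c) (Tf c) ∧ firstSingP (Nf c) (Tf c) ≤ Nf c
  · rw [if_pos h, decide_eq_true h]; rfl
  · rw [if_neg h, decide_eq_false h]; rfl

/-- `s(d) = (d - 1)/k` in binary. [cite: AroraBarak2009, §1.3] -/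
theorem sOfFP (k : ℕ) : CodeFP unE natE (sOf k) :=
  (natDiv.comp ((natSub.comp (natOfUn.pair (const _ 1))).pair (const _ k))).congr fun _ => rfl

/-- `s(d)` in unary (capped conversion with the budget `d ≥ s(d)`). [cite: AroraBarak2009, §1.3] -/
theorem usOfFP (k : ℕ) : CodeFP unE unE (sOf k) :=
  (unOfNatMin.comp ((CodeFP.id unE).pair (sOfFP k))).congr fun d =>
    min_eq_left ((Nat.div_le_self _ _).trans (Nat.sub_le d 1))

/-- An explicit point family is a `CodeFP` map `s ↦ H₀ s` from unary to raw point lists.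
[cite: GuoKumarSaptharishiSolomon2019, §1.2 (arXiv p0006.txt:L28)] -/
theorem codeFP_of_isExplicitPoints {H₀ : ℕ → List (List ℚ)} (hH₀ : IsExplicitPoints H₀) :
    CodeFP unE (rawE (rawE encodeRat)) H₀ := by
  obtain ⟨g, hg, hgH⟩ := hH₀
  have h1 : CodeFP unE (listE (listE encodeRat)) H₀ :=
    ⟨g, hg, fun s => by rw [← encodePoints_eq]; exact hgH s⟩
  exact ((map₀ (rawOfList encodeRat)).comp ((rawOfList _).comp h1)).congr fun s => by simp

/-- **The dense-list program on codes**: `1^d ↦ bootDenseP k H₀ d` is computed by a polynomial-time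
string function, for an explicit point family `H₀`. [cite: GuoKumarSaptharishiSolomon2019, §3.3 (arXiv p0014.txt:L5, "explicit family")] [cite: AroraBarak2009, §1.3] -/
theorem bootDensePFP (k : ℕ) {H₀ : ℕ → List (List ℚ)} (hH₀ : IsExplicitPoints H₀) :
    CodeFP unE (listE monoE) (bootDenseP k H₀) := by
  have hs := sOfFP k
  have hus := usOfFP k
  have hH : CodeFP unE (rawE (rawE encodeRat)) (fun d => H₀ (sOf k d)) :=
    (codeFP_of_isExplicitPoints hH₀).comp hus
  have hT : CodeFP unE (rawE (rawE intE)) (fun d => tableP k (sOf k d) (H₀ (sOf k d))) :=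
    tableFP k (sf := sOf k) (Hf := fun d => H₀ (sOf k d)) hus hs hH
  have huN : CodeFP unE unE (fun d => (sOf k d + 1) ^ k) :=
    ((ulength unitE).comp ((unitsPow k).comp (unSucc.comp hus))).congr fun d => by simp
  have hN : CodeFP unE natE (fun d => (sOf k d + 1) ^ k) := natOfUn.comp huN
  have huN1 : CodeFP unE unE (fun d => (sOf k d + 1) ^ k + 1) := unSucc.comp huN
  have hJ : CodeFP unE natE (fun d => firstSingP ((sOf k d + 1) ^ k) (tableP k (sOf k d) (H₀ (sOf k d)))) :=
    firstSingFP (Tf := fun d => tableP k (sOf k d) (H₀ (sOf k d))) (Nf := fun d => (sOf k d + 1) ^ k) hT huN1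
  have hJle : ∀ d, firstSingP ((sOf k d + 1) ^ k) (tableP k (sOf k d) (H₀ (sOf k d))) ≤
      (sOf k d + 1) ^ k + 1 := fun d => by
    have := List.findIdx_le_length
      (p := fun j => decide (0 < j ∧ detZ (gramP (tableP k (sOf k d) (H₀ (sOf k d))) j) = 0))
      (xs := List.range ((sOf k d + 1) ^ k + 1))
    simpa [firstSingP] using this
  have huJ : CodeFP unE unE (fun d => firstSingP ((sOf k d + 1) ^ k) (tableP k (sOf k d) (H₀ (sOf k d)))) :=
    (unOfNatMin.comp (huN1.pair hJ)).congr fun d => min_eq_left (hJle d)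
  have hG : CodeFP unE (rawE (rawE natE)) (fun d => gridLists k (sOf k d + 1)) :=
    gridListsFP (unSucc.comp hus) ((natAdd.comp (hs.pair (const _ 1))).congr fun _ => rfl) k
  -- the item map `i ↦ (0 :: G[i], (x_i, 1))` and the filter `x_i ≠ 0`, with context `d`
  let ctx : ℕ × ℕ → List Bool := pairE unE natE
  have cd : CodeFP ctx unE (fun c => c.1) := fst _ _
  have cker : CodeFP ctx intE (fun c => kerCoeffP ((sOf k c.1 + 1) ^ k)
      (tableP k (sOf k c.1) (H₀ (sOf k c.1))) c.2) :=
    kerCoeffFP (Tf := fun c : ℕ × ℕ => tableP k (sOf k c.1) (H₀ (sOf k c.1)))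
      (Nf := fun c => (sOf k c.1 + 1) ^ k) (i_f := fun c => c.2) (hT.comp cd) (hN.comp cd) (huN1.comp cd) (snd _ _)
  have ctest : CodeFP ctx bitE (fun c => !decide (kerCoeffP ((sOf k c.1 + 1) ^ k)
      (tableP k (sOf k c.1) (H₀ (sOf k c.1))) c.2 = 0)) :=
    (intEq.comp (cker.pair (const _ (0 : ℤ)))).not
  have cexp : CodeFP ctx (listE natE) (fun c => 0 :: (gridLists k (sOf k c.1 + 1)).getD c.2 []) :=
    (listOfRaw natE).comp ((rawCons natE).comp ((const _ 0).pair
      ((rawGetD (rawE natE) (rawE_nil natE)).comp ((hG.comp cd).pair (snd _ _)))))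
  have citem : CodeFP ctx monoE (fun c => (0 :: (gridLists k (sOf k c.1 + 1)).getD c.2 [],
      (kerCoeffP ((sOf k c.1 + 1) ^ k) (tableP k (sOf k c.1) (H₀ (sOf k c.1))) c.2, 1))) :=
    cexp.pair ((smOfInt.comp cker).pair (const _ 1))
  have hrange : CodeFP unE (rawE natE) (fun d => List.range
      (firstSingP ((sOf k d + 1) ^ k) (tableP k (sOf k d) (H₀ (sOf k d))))) := urange.comp huJ
  have hfilt := (filter (σ := ℕ) (eσ := unE) (p := fun c : ℕ × ℕ => !decide (kerCoeffP ((sOf k c.1 + 1) ^ k)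
      (tableP k (sOf k c.1) (H₀ (sOf k c.1))) c.2 = 0)) ctest).comp ((CodeFP.id unE).pair hrange)
  have hmain := (CodeFP.map (σ := ℕ) (eσ := unE) (g := fun c : ℕ × ℕ =>
      (0 :: (gridLists k (sOf k c.1 + 1)).getD c.2 [],
        (kerCoeffP ((sOf k c.1 + 1) ^ k) (tableP k (sOf k c.1) (H₀ (sOf k c.1))) c.2, 1))) citem).comp
    ((CodeFP.id unE).pair hfilt)
  -- the padding monomial
  have hpad : CodeFP unE monoE (fun d => (d :: List.replicate k 0, ((1 : ℤ), 1))) :=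
    ((listOfRaw natE).comp ((rawCons natE).comp (natOfUn.pair (const _ (List.replicate k 0))))).pair
      ((const _ (1 : ℤ)).pair (const _ 1))
  have h := (listOfRaw monoE).comp ((rawAppend monoE).comp (hmain.pair ((rawSingleton monoE).comp hpad)))
  refine h.congr fun d => ?_
  simp only [bootDenseP, id]
  congr 1
  refine congrArg _ (List.filter_congr fun i _ => ?_)
  simp

/-- **Explicitness of the padded family**: `d ↦ P'_d` is an explicit family in the dense
representation (the `d = 0` member is output as a constant). [cite: GuoKumarSaptharishiSolomon2019, §3.3 (arXiv p0014.txt:L5, "{P_s} is an explicit family"), Question 4 footnote (p0005.txt:L2)] -/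
theorem isExplicitFamily_bootFamily (k : ℕ) {H₀ : ℕ → List (List ℚ)} (hH₀ : IsExplicitPoints H₀) :
    IsExplicitFamily (k := fun _ => k + 1) (bootFamily k H₀) := by
  have htest : CodeFP unE bitE (fun d => decide (d = 0)) := natEq.comp (natOfUn.pair (const _ 0))
  have hprog : CodeFP unE (listE monoE) (fun d => if decide (d = 0) then denseList (bootFamily k H₀ 0)
      else bootDenseP k H₀ d) := htest.ite (const _ _) (bootDensePFP k hH₀)
  have hfun : CodeFP unE (listE monoE) (fun d => denseList (bootFamily k H₀ d)) :=
    hprog.congr fun d => by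
      by_cases hd : d = 0
      · subst hd; simp
      · have h1 := denseList_bootFamily (k := k) H₀ (Nat.one_le_iff_ne_zero.mpr hd)
        simp [hd, bootDenseP_eq, h1]
  obtain ⟨f, hf, hfF⟩ := hfun
  refine ⟨f, hf, fun d => ?_⟩
  rw [monomialListEncoding_eq]
  exact hfF d

end Code


end GKSS2019

/-! ### The discharge -/

open GKSS2019 HittingSets Literature.Barriers.ValiantsHypothesis in
/-- **GKSS ‹Bootstrapping hitting sets› holds (typed form `GKSS2019_bootstrapping`, over `ℚ`).**
Proof as printed (§3.3): from the explicit hitting sets `H₀ s` for `𝒞(k, i-deg: s, s^δ)` of size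
`≤ (s+1)^k − 1` extract the explicit hard family (`bootFamily`: `vanishingPoly` padded to exact
degree, `k+1` variables, hardness `d^{δ/2}` by `eventually_hard_bootFamily`, explicit by
`isExplicitFamily_bootFamily`) and apply ‹Thm 5› (`GKSS2019_thm_5_holds`).
[cite: GuoKumarSaptharishiSolomon2019, Thm ‹Bootstrapping hitting sets› (arXiv p0005.txt:L44–p0006.txt:L2), proof §3.3 (p0013.txt:L56 – p0014.txt:L8)] -/
theorem GKSS2019_bootstrapping_holds : GKSS2019_bootstrapping := by
  rintro k δ hk hδ ⟨H₀, hexp, s₀, hH₀⟩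
  exact GKSS2019_thm_5_holds (k + 1) (δ / 2) (Nat.succ_pos k) (half_pos hδ) (bootFamily k H₀)
    (isExplicitFamily_bootFamily k hexp) (fun d hd => totalDegree_bootFamily H₀ hd)
    (eventually_hard_bootFamily hk hδ hH₀)


end Literature.Computability.AlgebraicComplexity

end
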